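import Literature.NumberTheory.Automorphic.BrandtColumnSums
import Literature.NumberTheory.Automorphic.BrandtModuleMultiplicativity
import Literature.NumberTheory.EllipticCurves.LFunctionCoefficientBound
import HarnessLib

/-!
# Cuspidal eigenvectors of the Brandt matrices have degree zero

Topic `NumberTheory/Automorphic`; theorems only (no definition, no named fact, no instance).
A brick of identification (iii) of `Literature/NumberTheory/EllipticCurves/TakahashiDegreeFormula.lean`
(Takahashi 2001, Thm. 2.3 for `D = 1`, input (M4)–(M5) of its proof file): under Ribet's
description of the character group `X_r(J₀(rM))` as the **degree-zero** part `ℤ[Cls O]⁰` of the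
Brandt module (Ribet 1990, §3; Takahashi 2001, p. 84), the `a(f)`-eigen-line `L_r(J) ⊆ X_r(J)`
must be compared with the tree's eigen-lattice `Brandt.eigenLattice N T λ ⊆ ℤ^{Cls O}`, which is
cut out in the *whole* module `ℤ[Cls O]`. The two agree because eigenvectors for a cuspidal
system of eigenvalues are automatically of degree zero — they are orthogonal to the Eisenstein
vector. Printed argument (Gross 1987, §1 and Prop. 2.3 ff.: `e₀ = Σ e_i / w_i` spans the
`t_p = p + 1` eigenspace, "the Eisenstein subspace"; Eichler 1973, II §6: the Brandt matrix
`B(p)`, `p ∤` level, has row sums `p + 1`): the row vector `(1, …, 1)` is a left eigenvector of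
`T(p)` with eigenvalue the common column sum `s_p` (`= p + 1`), so `T(p) v = λ_p v` gives
`s_p Σ v_i = λ_p Σ v_i`, whence `Σ v_i = 0` as soon as `λ_p ≠ s_p` for one such `p`; and for
`λ = (a_n(E))_n`, `E/ℚ` an elliptic curve, `a_p(E) ≤ 2√p < p + 1` for every prime `p` (Hasse).

## Contents (namespace `Literature.NumberTheory.Automorphic.Brandt`)

* `sum_eq_zero_of_mulVec_eq_smul` — the linear algebra: constant column sums `s`, `T v = λ v`,
  `λ ≠ s` ⇒ `Σ_i v_i = 0` (any commutative ring without zero divisors).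
* `sum_eq_zero_of_mem_eigenLattice` — for the eigen-lattice `L(λ)` of `BrandtXi.lean`: one prime
  `p ∤ N` at which the columns of `T(p)` have a common sum `≠ λ(p)` forces degree zero.
* `XiSetup.sum_matrix_eq_ncard_subideals` — in a Brandt setup the `j`-th column sum of `T(n)` is
  the number of invertible right `O`-sub-ideals of `I_j` of index `n²` (the tree's
  `Brandt.sum_matrix_eq_ncard`, its closure hypothesis discharged by
  `Brandt.units_smul_mem_rightIdeals_of_isTotallyDefinite`).
* `WeierstrassCurve.lFunction_lt_prime_add_one`, `…_ne_prime_add_one` — `a_p(E) < p + 1` from the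
  tree's Hasse bound `|a_p(E)| ≤ 2√p` (`WeierstrassCurve.abs_LFunction_prime_pow_le`).
* `sum_eq_zero_of_mem_eigenLattice_lFunction`, `XiSetup.sum_eq_zero_of_mem_eigenLattice_lFunction`
  — **degree zero of the `a(E)`-eigen-lattice**, granted that for one prime `p ∤ N` the columns of
  `T(p)` sum to `p + 1` (resp. that every representative ideal `I_j` has exactly `p + 1` invertible
  right sub-ideals of index `p²`). That count (Eichler 1973, II §6 (16): `B(p)` has row sums
  `p + 1` for `p` prime to the level; locally the `p + 1` right ideals of norm `p` of `M₂(ℤ_p)`) is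
  the one arithmetic input NOT proved here; it is carried as an explicit hypothesis, in the two
  equivalent forms.

## References

* [Takahashi2001] S. Takahashi, J. Number Theory 90 (2001), §2 p. 78 (`L_r(J)`), §3.2 p. 84.
* [Ribet1990] K. Ribet, Invent. Math. 100 (1990), §3 (character group and supersingular divisors
  of degree zero).
* [Gross1987] B. H. Gross, Heights and the special values of L-series (1987), §1, §2 (Eisenstein
  vector `e₀`, `deg`).
* [Eichler1973] M. Eichler, The basis problem for modular forms and the traces of the Hecke
  operators, LNM 320 (1973), Ch. II §6 (row sums of `B(p)`).
-/

noncomputable section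

open scoped Pointwise BigOperators Matrix

universe u

namespace Literature.NumberTheory.Automorphic

namespace Brandt

/-! ### Linear algebra: constant column sums kill the degree of non-Eisenstein eigenvectors -/

section Abstract

variable {ι : Type*} [Fintype ι] {R : Type*} [CommRing R] [NoZeroDivisors R]

omit [NoZeroDivisors R] in
/-- The sum of the coordinates of `T v` is `s · Σ_j v_j` when every column of `T` sums to `s`
(`(1,…,1) T = s (1,…,1)`). [folklore] -/
theorem sum_mulVec_eq_mul_sum (T : Matrix ι ι R) {s : R} (hcol : ∀ j, ∑ i, T i j = s)
    (v : ι → R) : ∑ i, (T *ᵥ v) i = s * ∑ j, v j := by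
  simp only [Matrix.mulVec, dotProduct]
  rw [Finset.sum_comm, Finset.mul_sum]
  refine Finset.sum_congr rfl fun j _ => ?_
  rw [← Finset.sum_mul, hcol]

/-- **Eigenvectors off the column-sum eigenvalue have degree zero**: if every column of `T` sums
to `s` and `T v = λ v` with `λ ≠ s`, then `Σ_i v_i = 0` (the row vector `(1, …, 1)` is a left
`s`-eigenvector, so `s Σ v_i = λ Σ v_i`). For Brandt matrices this is the orthogonality of
cuspidal eigenvectors to Gross's Eisenstein vector (Gross 1987, §2). [folklore] -/
theorem sum_eq_zero_of_mulVec_eq_smul (T : Matrix ι ι R) {s lam : R} (hcol : ∀ j, ∑ i, T i j = s)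
    {v : ι → R} (hv : T *ᵥ v = lam • v) (hne : lam ≠ s) : ∑ i, v i = 0 := by
  have h1 := sum_mulVec_eq_mul_sum T hcol v
  rw [hv] at h1
  simp only [Pi.smul_apply, smul_eq_mul] at h1
  rw [← Finset.mul_sum] at h1
  have h2 : (lam - s) * ∑ i, v i = 0 := by rw [sub_mul, h1, sub_self]
  rcases mul_eq_zero.mp h2 with h | h
  · exact absurd (sub_eq_zero.mp h) hne
  · exact h

/-- **Degree zero on the eigen-lattice** `L(λ) = {v : T(p) v = λ(p) v, p prime, p ∤ N}` of
`BrandtXi.lean`: if for ONE prime `p ∤ N` the columns of `T(p)` have a common sum `s ≠ λ(p)`, every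
`v ∈ L(λ)` has `Σ_i v_i = 0`. [folklore] -/
theorem sum_eq_zero_of_mem_eigenLattice {N : ℕ} {T : ℕ → Matrix ι ι ℤ} {lam : ℕ → ℤ} {v : ι → ℤ}
    (hv : v ∈ eigenLattice N T lam) {p : ℕ} (hp : p.Prime) (hpN : ¬ p ∣ N) {s : ℤ}
    (hcol : ∀ j, ∑ i, T p i j = s) (hne : lam p ≠ s) : ∑ i, v i = 0 :=
  sum_eq_zero_of_mulVec_eq_smul (T p) hcol (hv p hp hpN) hne

/-- The same for a line: if `L(λ) = ℤ φ` under the hypotheses of `sum_eq_zero_of_mem_eigenLattice`,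
the generator `φ` has degree zero. [folklore] -/
theorem sum_eq_zero_of_eigenLattice_eq_span {N : ℕ} {T : ℕ → Matrix ι ι ℤ} {lam : ℕ → ℤ}
    {φ : ι → ℤ} (hL : eigenLattice N T lam = ℤ ∙ φ) {p : ℕ} (hp : p.Prime) (hpN : ¬ p ∣ N)
    {s : ℤ} (hcol : ∀ j, ∑ i, T p i j = s) (hne : lam p ≠ s) : ∑ i, φ i = 0 :=
  sum_eq_zero_of_mem_eigenLattice (hL ▸ Submodule.mem_span_singleton_self φ) hp hpN hcol hne

end Abstract

/-! ### Column sums of the Brandt matrices of a setup count invertible sub-ideals -/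

section Setup

variable {Nplus Nminus : ℕ}

/-- In a Brandt setup `S = (D, O)` the `j`-th column sum of `T(n)` (`n ≥ 1`) is the number of
invertible right `O`-ideals `M ⊆ I_j` of index `[I_j : M] = n²` (the tree's
`Brandt.sum_matrix_eq_ncard`, Vignéras III §5 Ex. 5.8 (a), with its closure hypothesis — unit
translates of right ideals are right ideals — discharged in the totally definite algebra `D` by
`Brandt.units_smul_mem_rightIdeals_of_isTotallyDefinite`).
[cite: VignerasLNM800, Ch. III §5 exercice 5.8 (a)] -/
theorem XiSetup.sum_matrix_eq_ncard_subideals (S : XiSetup Nplus Nminus) [Fintype (ClassSet S.O)]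
    {n : ℕ} (hn : n ≠ 0) (j : ClassSet S.O) :
    ∑ i, matrix S.O n i j =
      ({M : Submodule ℤ S.D | M ≤ j.rep ∧ M.toAddSubgroup.relIndex j.rep.toAddSubgroup = n ^ 2 ∧
          M ∈ rightIdeals S.O}.ncard : ℤ) :=
  haveI : IsAddTorsionFree S.D := S.isAddTorsionFree
  sum_matrix_eq_ncard
    (fun _ hI β => units_smul_mem_rightIdeals_of_isTotallyDefinite S.isTotallyDefinite
      S.isEichlerOrder.isOrder hI β) hn j

end Setup

end Brandt

end Literature.NumberTheory.Automorphic

/-! ### Hasse: `a_p(E) < p + 1` -/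

namespace WeierstrassCurve

/-- **`a_p(E) < p + 1`** for every elliptic curve `E/ℚ` and every prime `p`: by Hasse's bound in
the tree's form `|a_p(E)| ≤ 2√p` (`WeierstrassCurve.abs_LFunction_prime_pow_le` with `k = 1`) and
`2√p < p + 1` (i.e. `(√p - 1)² > 0`, `p ≠ 1`). Here `a_p(E) = W.LFunction p` is the `p`-th
coefficient of Mathlib's `L`-function of the model `W`. (Dot-notation extension of the Mathlib
namespace `WeierstrassCurve`.) [folklore] -/
theorem lFunction_lt_prime_add_one (W : WeierstrassCurve ℚ) [W.IsElliptic] {p : ℕ} (hp : p.Prime) :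
    W.LFunction p < p + 1 := by
  have hb := W.abs_LFunction_prime_pow_le hp 1
  rw [pow_one, pow_one] at hb
  have hle : (W.LFunction p : ℝ) ≤ 2 * Real.sqrt p := (le_abs_self _).trans (by norm_num at hb ⊢; exact hb)
  have hp0 : (0 : ℝ) ≤ p := Nat.cast_nonneg p
  have hsq : Real.sqrt p ^ 2 = p := Real.sq_sqrt hp0
  have hne : Real.sqrt p ≠ 1 := by
    intro h1
    have : (p : ℝ) = 1 := by rw [← hsq, h1, one_pow]
    exact hp.one_lt.ne' (by exact_mod_cast this)
  have hlt : 2 * Real.sqrt p < p + 1 := by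
    nlinarith [sq_pos_of_ne_zero (sub_ne_zero.mpr hne), Real.sqrt_nonneg (p : ℝ)]
  have : (W.LFunction p : ℝ) < (p : ℝ) + 1 := hle.trans_lt hlt
  exact_mod_cast this

/-- `a_p(E) ≠ p + 1` (the Eisenstein eigenvalue of `T(p)`) for every prime `p`.
(Dot-notation extension of the Mathlib namespace `WeierstrassCurve`.) [folklore] -/
theorem lFunction_ne_prime_add_one (W : WeierstrassCurve ℚ) [W.IsElliptic] {p : ℕ} (hp : p.Prime) :
    W.LFunction p ≠ p + 1 :=
  (W.lFunction_lt_prime_add_one hp).ne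

end WeierstrassCurve

namespace Literature.NumberTheory.Automorphic

namespace Brandt

/-! ### Degree zero of the `a(E)`-eigen-lattice -/

section EllipticCurve

variable {ι : Type*} [Fintype ι]

/-- **The `a(E)`-eigen-lattice lies in the degree-zero part**, abstract Brandt data: if for one
prime `p ∤ N` the columns of `T(p)` all sum to `p + 1` (Eichler 1973, II §6 (16), for the Brandt
matrices of an Eichler order and `p` prime to the level), then every `v` with
`T(q) v = a_q(E) v` (`q ∤ N` prime) satisfies `Σ_i v_i = 0`, because `a_p(E) ≠ p + 1` (Hasse).
This is the statement that the tree's `eigenLattice N T (a(E))`, cut out in all of `ℤ^{Cls O}`,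
already lies in `ℤ[Cls O]⁰ ≅ X_r(J₀(N))` (Ribet 1990 §3; Takahashi 2001 p. 84).
[cite: Gross1987, §2 (Eisenstein vector and degree)] -/
theorem sum_eq_zero_of_mem_eigenLattice_lFunction (W : WeierstrassCurve ℚ) [W.IsElliptic] {N : ℕ}
    {T : ℕ → Matrix ι ι ℤ} {v : ι → ℤ} (hv : v ∈ eigenLattice N T fun n => W.LFunction n)
    {p : ℕ} (hp : p.Prime) (hpN : ¬ p ∣ N) (hcol : ∀ j, ∑ i, T p i j = p + 1) : ∑ i, v i = 0 :=
  sum_eq_zero_of_mem_eigenLattice hv hp hpN hcol (W.lFunction_ne_prime_add_one hp)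

variable {Nplus Nminus : ℕ}

/-- **Degree zero in a Brandt setup**, with the arithmetic input in its ideal-counting form: if for
one prime `p ∤ N⁺N⁻` every representative ideal `I_j` of `Cls O` has exactly `p + 1` invertible
right `O`-sub-ideals of index `p²` (Eichler 1973, II §6 (16); locally these are the `p + 1` right
ideals of norm `p` of `M₂(ℤ_p) ≅ O_p`), then every element of the `a(E)`-eigen-lattice of the
Brandt matrices of `S` has degree zero. [cite: Gross1987, §2 (Eisenstein vector and degree)] -/
theorem XiSetup.sum_eq_zero_of_mem_eigenLattice_lFunction (S : XiSetup Nplus Nminus)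
    [Fintype (ClassSet S.O)] (W : WeierstrassCurve ℚ) [W.IsElliptic] {v : ClassSet S.O → ℤ}
    (hv : v ∈ eigenLattice (Nplus * Nminus) (matrix S.O) fun n => W.LFunction n)
    {p : ℕ} (hp : p.Prime) (hpN : ¬ p ∣ Nplus * Nminus)
    (hcount : ∀ j : ClassSet S.O,
      {M : Submodule ℤ S.D | M ≤ j.rep ∧ M.toAddSubgroup.relIndex j.rep.toAddSubgroup = p ^ 2 ∧
          M ∈ rightIdeals S.O}.ncard = p + 1) :
    ∑ i, v i = 0 := by
  refine Brandt.sum_eq_zero_of_mem_eigenLattice_lFunction W hv hp hpN fun j => ?_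
  rw [S.sum_matrix_eq_ncard_subideals hp.ne_zero j, hcount j]
  push_cast
  ring

end EllipticCurve

end Brandt

end Literature.NumberTheory.Automorphic

end
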